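import Summits.QuantumFields.YangMills.Theorems.BalabanUVNodesN18KingModelFinePoints

/-!
# BalabanUVNodes ∕ N18 — BLOCK MEANS: the test weights of the fine-point polymer representation ARE inhabited by the quadratic
# form of block-averaged fields — King's blocks have `N^d` fine points, the product of two block means of fields bounded by one
# is block-ℓ¹-normalised, and module 5c's capstone specialises to `⟨Qu, [ℋCℋ] Qv⟩`-type insertions with `NE5` and (0.25)
# (Track A, DAG node N18 = NE5 `T4OutputRate.NE5 EA EB W κ θ C₅` :211; director-ym R134 row n18 s3 «King-model transfer
# `N18KingModelTorus` (κ, C₅ from (d, L, a, m², γ)) → `TwoRunTorusNE5Final*`», module 7 of seat pub-ymgap-dag-n18-e)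

HONEST FRAMING.  Count-neutral kernel bookkeeping (seat pub-ymgap-dag-n18-e g5, strategy s3; `--supports` K3′
`SpineGivenEndpointR12`, helper).  Finite torus-block combinatorics (`King1986.Torus.blockEquiv ∕ site ∕ blockOf`) and one
application of module 5c (p478596 `N18KingModelFinePoints.kingModel_polymerRep_finePoints`); King's `A = 0` scalar MODEL —
NOT Bałaban's covariant one-step outputs `E^{(j)}(X; g, U_k(V))` of [Balaban1987RG1] (0.24)∕(2.13), for which NE5 is NOT IN PRINT
and has no tree producer (NODE O instance 0∕1); NOT a node discharge; finite tori; nothing continuum ∕ ℝ⁴ ∕ OS ∕ mass-gap ∕ Clay.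
THEOREMS ONLY: 0 `def`, 0 `sorry`, standard axioms.

THE POINT.  Module 5c reads King's (4.42) graphs at every fine point against test weights `w_j(φ)(x′, y′)` on run B's fine pairs
that are BLOCK-ℓ¹-NORMALISED — `Σ_{B(x′) = p, B(y′) = q} |w_j(φ)(x′, y′)| ≤ 1` — a HYPOTHESIS; the seat's census (vii) asked for the
quadratic-form reading.  THIS FILE shows the hypothesis is inhabited by the canonical insertion, the product of BLOCK MEANS
`w(x′, y′) = N^{−d}u(x′)·N^{−d}v(y′)` of two fields bounded by one (King's block-mean projector `Q*Q`, (4.36) p. 674: `(Q*Qφ)(y) =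
N^{−d} Σ_{y′ ∈ B(y)} φ(y′)`), and records the specialisation:
* §1 (generic, King's torus blocks `Π ℤ∕(N·M_μ) → Π ℤ∕M_μ`) `sum_blockFibre_eq_sum_site` (a sum over the fine points of one block is the
  sum over its `N^d` offsets `site N M b j` — `blockEquiv`, `blockOf_site`), `card_blockFibre` (`|B⁻¹(b)| = N^d`),
  `sum_blockFibre_mean_le_one` (`Σ_{B(y)=b} N^{−d}|u(y)| ≤ 1` for `|u| ≤ 1`), `sum_blockPairFibre` (a sum over the fine
  lines of a block pair factors through the two blocks), **`blockMeans_normalised`** (`Σ_{(B(x),B(y)) = (p,q)}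
  |N^{−d}u(x)·N^{−d}v(y)| ≤ 1`).
* §2 **`kingModel_polymerRep_blockMeans`** — module 5c with `w_j(φ)(x′,y′) := N_j^{−4}u_j(φ)(x′)·N_j^{−4}v_j(φ)(y′)`
  (`N_j = L^nL^{j+1}`, `|u|, |v| ≤ 1` configuration-dependent fields on run B's fine torus): activities `K_A, K_B` on the END's
  carriers with `NE5 … κ (L^{−γ∕2}) C₅`, `DecayBound … A κ` (both runs), the resummation
  `Σ_{X ∈ 𝐃_j} K⟨j,X⟩ φ = Σ_{x′,y′} N^{−4}u(x′)N^{−4}v(y′)·G(x′,y′)` = the (4.42) graph paired with the two block-averaged fields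
  (run A at the points under `x′, y′`), and locality over one and the same set of fine lines — the model of the second-order
  term of an effective action evaluated on block-averaged configurations.
WHAT THIS DOES NOT DO.  King's (2.20)-rescaling (block means are the `n`-UNIFORM normalisation; field-strength rescalings
`(L^jη)^{(2−d)∕2}` are not derived); vertex functions (module 6b composes but is not repeated); `A = 0`; NOT Bałaban's
`E^{(j)}(X; g, U)`.

Sources: C. King, Commun. Math. Phys. **102** (1986) 649–677 [King1986] — (4.36) p. 674 (`Q*Q`), Prop. 3.9 (3.73) p. 665, p. 664,
(4.42)–(4.43) p. 675; T. Bałaban, Commun. Math. Phys. **109** (1987) 249–301 [Balaban1987RG1] — (0.24)–(0.25) p. 257, (1.18)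
p. 263; **116** (1988) 1–22 [Balaban1988RG2Cluster] (2.30) p. 18.  No claim about the mass gap.
-/

noncomputable section

namespace Summit.QuantumFields.YangMills.BalabanUVNodes.N18KingModelBlockMeans

open Matrix
open Literature.MathematicalPhysics.QuantumFieldTheory.Balaban1983to89
open Literature.MathematicalPhysics.QuantumFieldTheory.Balaban1983to89.T4OutputRate (NE5 DecayBound)
open Literature.MathematicalPhysics.QuantumFieldTheory.Balaban1983to89.B5Prop11Plancherel (Tor fine)
open Literature.MathematicalPhysics.QuantumFieldTheory.Balaban1983to89.TreeLengthTorus (TPt TDom)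
open Literature.MathematicalPhysics.QuantumFieldTheory.Balaban1983to89.B13Lemma3Torus (TwoTorusStep)
open Literature.MathematicalPhysics.QuantumFieldTheory.King1986 (aK)
open Literature.MathematicalPhysics.QuantumFieldTheory.King1986.Torus
  (minimiser effLaplacian blockProj site blockOf blockOf_site blockEquiv blockEquiv_apply)
open Summit.QuantumFields.BalabanUV.T4Continuum.Spine.NE5.TwoRunTorusNE5 (torusCarriers reFunctional)
open Summit.QuantumFields.YangMills.BalabanUVNodes.N18KingModelFinePoints (kingModel_polymerRep_finePoints)

/-! ## §1 Sums over a block: the fibre of `blockOf` is parametrised by `site` -/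

section Blocks
variable {d : ℕ} (N : ℕ) [NeZero N] (M : Fin d → ℕ) [∀ μ, NeZero (M μ)]

open Classical in
/-- **A SUM OVER THE FINE POINTS OF ONE BLOCK** is the sum over the block's `N^d` offsets: `Σ_{y : B(y) = b} f(y) =
Σ_{j ∈ [0,N)^d} f(N·b + j)` (`King1986.Torus.blockEquiv`, `blockOf_site`). [cite: King1986, (4.36) p.674] -/
theorem sum_blockFibre_eq_sum_site (f : Tor (fine N M) → ℝ) (b : Tor M) :
    ∑ y ∈ Finset.univ.filter (fun y => blockOf N M y = b), f y = ∑ j : Fin d → Fin N, f (site N M b j) := by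
  rw [Finset.sum_filter, ← Equiv.sum_comp (blockEquiv N M), Fintype.sum_prod_type]
  simp only [blockEquiv_apply, blockOf_site]
  rw [Finset.sum_eq_single b (fun b' _ hb' => by simp [hb']) (fun h => absurd (Finset.mem_univ b) h)]
  simp

open Classical in
/-- **A block has `N^d` fine points.** [cite: King1986, (4.36) p.674] -/
theorem card_blockFibre (b : Tor M) :
    ((Finset.univ.filter (fun y => blockOf N M y = b)).card : ℝ) = (N : ℝ) ^ d := by
  have h := sum_blockFibre_eq_sum_site N M (fun _ => (1 : ℝ)) b
  rw [Finset.sum_const, nsmul_eq_mul, mul_one, Finset.sum_const, nsmul_eq_mul, mul_one, Finset.card_univ,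
    Fintype.card_fun, Fintype.card_fin, Fintype.card_fin] at h
  rw [h]
  push_cast
  ring

open Classical in
/-- **The block mean of a field bounded by one has modulus at most one, summed over the block**:
`Σ_{y : B(y) = b} N^{−d}|u(y)| ≤ 1`. [cite: King1986, (4.36) p.674] -/
theorem sum_blockFibre_mean_le_one {u : Tor (fine N M) → ℝ} (hu : ∀ y, |u y| ≤ 1) (b : Tor M) :
    ∑ y ∈ Finset.univ.filter (fun y => blockOf N M y = b), ((N : ℝ) ^ d)⁻¹ * |u y| ≤ 1 := by
  have hN : (0 : ℝ) < (N : ℝ) ^ d := by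
    have : (0 : ℝ) < N := by exact_mod_cast Nat.pos_of_ne_zero (NeZero.ne N)
    positivity
  calc ∑ y ∈ Finset.univ.filter (fun y => blockOf N M y = b), ((N : ℝ) ^ d)⁻¹ * |u y|
      ≤ ∑ _y ∈ Finset.univ.filter (fun y => blockOf N M y = b), ((N : ℝ) ^ d)⁻¹ * 1 :=
        Finset.sum_le_sum fun y _ => mul_le_mul_of_nonneg_left (hu y) (inv_nonneg.2 hN.le)
    _ = ((Finset.univ.filter (fun y => blockOf N M y = b)).card : ℝ) * ((N : ℝ) ^ d)⁻¹ := by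
        rw [Finset.sum_const, nsmul_eq_mul, mul_one]
    _ = 1 := by rw [card_blockFibre, mul_inv_cancel₀ hN.ne']

open Classical in
/-- **A sum over the fine LINES of a block pair** factors through the two blocks:
`Σ_{(x,y) : (B(x), B(y)) = (p, q)} g(x, y) = Σ_{x : B(x) = p} Σ_{y : B(y) = q} g(x, y)`. [folklore] -/
theorem sum_blockPairFibre (g : Tor (fine N M) × Tor (fine N M) → ℝ) (pq : Tor M × Tor M) :
    ∑ xy ∈ Finset.univ.filter (fun xy : Tor (fine N M) × Tor (fine N M) =>
        (blockOf N M xy.1, blockOf N M xy.2) = pq), g xy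
      = ∑ x ∈ Finset.univ.filter (fun x => blockOf N M x = pq.1),
          ∑ y ∈ Finset.univ.filter (fun y => blockOf N M y = pq.2), g (x, y) := by
  rw [← Finset.sum_product]
  refine Finset.sum_congr ?_ fun _ _ => rfl
  ext xy
  simp only [Finset.mem_filter, Finset.mem_univ, true_and, Finset.mem_product, Prod.ext_iff]

open Classical in
/-- **BLOCK MEANS ARE BLOCK-ℓ¹-NORMALISED TEST WEIGHTS** (the hypothesis of module 5c `kingModel_polymerRep_finePoints`): for two
fields `u, v` bounded by one on the fine torus, the product of block means `w(x, y) = N^{−d}u(x)·N^{−d}v(y)` satisfies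
`Σ_{(x,y) : (B(x), B(y)) = (p,q)} |w(x, y)| ≤ 1` for every block pair — the quadratic form of the block-averaged fields.
[cite: King1986, (4.36) p.674, p.664] -/
theorem blockMeans_normalised {u v : Tor (fine N M) → ℝ} (hu : ∀ x, |u x| ≤ 1) (hv : ∀ y, |v y| ≤ 1)
    (pq : Tor M × Tor M) :
    ∑ xy ∈ Finset.univ.filter (fun xy : Tor (fine N M) × Tor (fine N M) =>
        (blockOf N M xy.1, blockOf N M xy.2) = pq),
      |((N : ℝ) ^ d)⁻¹ * u xy.1 * (((N : ℝ) ^ d)⁻¹ * v xy.2)| ≤ 1 := by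
  have hN : (0 : ℝ) ≤ ((N : ℝ) ^ d)⁻¹ := by positivity
  rw [sum_blockPairFibre]
  have hterm : ∀ x y : Tor (fine N M),
      |((N : ℝ) ^ d)⁻¹ * u x * (((N : ℝ) ^ d)⁻¹ * v y)|
        = (((N : ℝ) ^ d)⁻¹ * |u x|) * (((N : ℝ) ^ d)⁻¹ * |v y|) := by
    intro x y
    rw [abs_mul, abs_mul, abs_mul, abs_of_nonneg hN]
  simp only [hterm]
  calc ∑ x ∈ Finset.univ.filter (fun x => blockOf N M x = pq.1),
        ∑ y ∈ Finset.univ.filter (fun y => blockOf N M y = pq.2),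
          ((N : ℝ) ^ d)⁻¹ * |u x| * (((N : ℝ) ^ d)⁻¹ * |v y|)
      = (∑ x ∈ Finset.univ.filter (fun x => blockOf N M x = pq.1), ((N : ℝ) ^ d)⁻¹ * |u x|)
          * ∑ y ∈ Finset.univ.filter (fun y => blockOf N M y = pq.2), ((N : ℝ) ^ d)⁻¹ * |v y| := by
        rw [Finset.sum_mul_sum]
    _ ≤ 1 * 1 :=
        mul_le_mul (sum_blockFibre_mean_le_one N M hu pq.1) (sum_blockFibre_mean_le_one N M hv pq.2)
          (Finset.sum_nonneg fun y _ => mul_nonneg hN (abs_nonneg _)) zero_le_one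
    _ = 1 := one_mul 1

end Blocks

/-! ## §2 Module 5c on block means: the quadratic form of block-averaged fields -/

section Capstone
variable {L' : ℕ} [NeZero L']

open Classical in
/-- **THE POLYMER REPRESENTATION OF KING'S MODEL PAIRED WITH TWO BLOCK-AVERAGED FIELDS.**  Module 5c
`kingModel_polymerRep_finePoints` with the test weights the product of BLOCK MEANS `N_j^{−4}u_j(φ)(x′)·N_j^{−4}v_j(φ)(y′)`
(`N_j = L^nL^{j+1}` fine points per unit side; `u, v` any scale∕configuration-indexed fields on run B's fine torus bounded by
one — e.g. a bounded function of the configuration `φ`): `∃ κ > 0, A ≥ 0, C₅ ≥ 0` ((L, a, m², γ) only) such that for all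
admissible data there are activities `K_A, K_B` on the END's carriers with (a) `NE5 … κ (L^{−γ∕2}) C₅`, (d) `DecayBound … A κ`
for both runs, (b) `Σ_{X ∈ 𝐃_j} K_A⟨j,X⟩ φ = Σ_{x′,y′} N^{−4}u(x′)·N^{−4}v(y′)·[ℋ_{j+1}C^{(j+1)}ℋ_{j+1}](x, y)` (run A at the points
under `x′, y′`) and the same for run B at `(x′, y′)`, (c) locality over one and the same set of fine lines whose blocks are
cubes of `X` — King's `⟨Q u, G Q v⟩`-type quadratic form split over connecting polymers.  5c + §1 `blockMeans_normalised`.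
[cite: King1986, (4.36) p.674, Prop. 3.9 (3.73) p.665, p.664, (4.42)–(4.43) p.675; Balaban1987RG1, (0.24)-(0.25) p.257, (1.18) p.263] -/
theorem kingModel_polymerRep_blockMeans (L : ℕ) [NeZero L] (hLp : Odd L ∧ 1 < L) {a m2 : ℝ} (ha : 0 < a) (hm : 0 < m2)
    {γ : ℝ} (hγ0 : 0 ≤ γ) (hγ1 : γ ≤ 1) :
    ∃ κ A C₅ : ℝ, 0 < κ ∧ 0 ≤ A ∧ 0 ≤ C₅ ∧
      ∀ (n : ℕ) (_hn : 1 ≤ n) (M : ℕ → ℕ) [∀ k, NeZero (M k)] (_hM : ∀ k, ∃ mm : ℕ, L * M k = 2 * L ^ mm)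
        (W : (j : ℕ) → TwoTorusStep 4 L' (L * M (j + 1)))
        (u v : (j : ℕ) → (W j).Φ → Tor (fine (L ^ n * L ^ (j + 1)) (fine L (fun _ : Fin 4 => M (j + 1)))) → ℝ)
        (_hu : ∀ j φ x, |u j φ x| ≤ 1) (_hv : ∀ j φ y, |v j φ y| ≤ 1)
        (W' : Set (ℕ → ℝ)),
        ∃ KA KB : (X : Σ j : ℕ, TDom 4 (L * M (j + 1))) → (W X.1).Φ → ℝ,
          NE5 (C := torusCarriers (fun j => L * M (j + 1)) W)
              (reFunctional (fun j => L * M (j + 1)) W fun j X φ => ((KA ⟨j, X⟩ φ : ℝ) : ℂ))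
              (reFunctional (fun j => L * M (j + 1)) W fun j X φ => ((KB ⟨j, X⟩ φ : ℝ) : ℂ)) W' κ
              ((L : ℝ) ^ (-(γ / 2))) C₅ ∧
          DecayBound (C := torusCarriers (fun j => L * M (j + 1)) W)
              (reFunctional (fun j => L * M (j + 1)) W fun j X φ => ((KA ⟨j, X⟩ φ : ℝ) : ℂ)) W' A κ ∧
          DecayBound (C := torusCarriers (fun j => L * M (j + 1)) W)
              (reFunctional (fun j => L * M (j + 1)) W fun j X φ => ((KB ⟨j, X⟩ φ : ℝ) : ℂ)) W' A κ ∧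
          (∀ (j : ℕ) (φ : (W j).Φ), ∑ X : TDom 4 (L * M (j + 1)), KA ⟨j, X⟩ φ =
            ∑ xy : Tor (fine (L ^ n * L ^ (j + 1)) (fine L (fun _ : Fin 4 => M (j + 1)))) ×
                Tor (fine (L ^ n * L ^ (j + 1)) (fine L (fun _ : Fin 4 => M (j + 1)))), ((((L ^ n * L ^ (j + 1) : ℕ) : ℝ) ^ 4)⁻¹ * u j φ xy.1 * ((((L ^ n * L ^ (j + 1) : ℕ) : ℝ) ^ 4)⁻¹ * v j φ xy.2)) *
              ((fun z => minimiser (L ^ (j + 1)) (fine L (fun _ : Fin 4 => M (j + 1))) (aK a L (j + 1))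
                    (((L ^ (j + 1) : ℕ) : ℝ) ^ 2) m2 (Pi.single z 1)
                    (fun μ => (((xy.1 μ).val / L ^ n : ℕ) :
                      ZMod (fine (L ^ (j + 1)) (fine L (fun _ : Fin 4 => M (j + 1))) μ))))
                ⬝ᵥ ((effLaplacian (L ^ (j + 1)) (fine L (fun _ : Fin 4 => M (j + 1))) (aK a L (j + 1))
                        (((L ^ (j + 1) : ℕ) : ℝ) ^ 2) m2
                      + (a * ((L : ℝ) ^ 2)⁻¹) • blockProj L (fun _ : Fin 4 => M (j + 1)))⁻¹
                    *ᵥ fun w' => minimiser (L ^ (j + 1)) (fine L (fun _ : Fin 4 => M (j + 1))) (aK a L (j + 1))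
                        (((L ^ (j + 1) : ℕ) : ℝ) ^ 2) m2 (Pi.single w' 1)
                        (fun μ => (((xy.2 μ).val / L ^ n : ℕ) :
                          ZMod (fine (L ^ (j + 1)) (fine L (fun _ : Fin 4 => M (j + 1))) μ)))))) ∧
          (∀ (j : ℕ) (φ : (W j).Φ), ∑ X : TDom 4 (L * M (j + 1)), KB ⟨j, X⟩ φ =
            ∑ xy : Tor (fine (L ^ n * L ^ (j + 1)) (fine L (fun _ : Fin 4 => M (j + 1)))) ×
                Tor (fine (L ^ n * L ^ (j + 1)) (fine L (fun _ : Fin 4 => M (j + 1)))), ((((L ^ n * L ^ (j + 1) : ℕ) : ℝ) ^ 4)⁻¹ * u j φ xy.1 * ((((L ^ n * L ^ (j + 1) : ℕ) : ℝ) ^ 4)⁻¹ * v j φ xy.2)) *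
              ((fun z => minimiser (L ^ n * L ^ (j + 1)) (fine L (fun _ : Fin 4 => M (j + 1))) (aK a L (j + 1 + n))
                    (((L ^ n * L ^ (j + 1) : ℕ) : ℝ) ^ 2) m2 (Pi.single z 1) xy.1)
                ⬝ᵥ ((effLaplacian (L ^ n * L ^ (j + 1)) (fine L (fun _ : Fin 4 => M (j + 1))) (aK a L (j + 1 + n))
                        (((L ^ n * L ^ (j + 1) : ℕ) : ℝ) ^ 2) m2
                      + (a * ((L : ℝ) ^ 2)⁻¹) • blockProj L (fun _ : Fin 4 => M (j + 1)))⁻¹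
                    *ᵥ fun w' => minimiser (L ^ n * L ^ (j + 1)) (fine L (fun _ : Fin 4 => M (j + 1)))
                        (aK a L (j + 1 + n)) (((L ^ n * L ^ (j + 1) : ℕ) : ℝ) ^ 2) m2 (Pi.single w' 1) xy.2))) ∧
          (∀ (j : ℕ) (X : TDom 4 (L * M (j + 1))) (φ : (W j).Φ),
            ∃ S : Finset (Tor (fine (L ^ n * L ^ (j + 1)) (fine L (fun _ : Fin 4 => M (j + 1)))) ×
                Tor (fine (L ^ n * L ^ (j + 1)) (fine L (fun _ : Fin 4 => M (j + 1))))),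
            (∀ xy ∈ S, (blockOf (L ^ n * L ^ (j + 1)) (fine L (fun _ : Fin 4 => M (j + 1))) xy.1,
                blockOf (L ^ n * L ^ (j + 1)) (fine L (fun _ : Fin 4 => M (j + 1))) xy.2) ∈ X.1 ×ˢ X.1) ∧
            KA ⟨j, X⟩ φ = ∑ xy ∈ S, ((((L ^ n * L ^ (j + 1) : ℕ) : ℝ) ^ 4)⁻¹ * u j φ xy.1 * ((((L ^ n * L ^ (j + 1) : ℕ) : ℝ) ^ 4)⁻¹ * v j φ xy.2)) *
              ((fun z => minimiser (L ^ (j + 1)) (fine L (fun _ : Fin 4 => M (j + 1))) (aK a L (j + 1))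
                    (((L ^ (j + 1) : ℕ) : ℝ) ^ 2) m2 (Pi.single z 1)
                    (fun μ => (((xy.1 μ).val / L ^ n : ℕ) :
                      ZMod (fine (L ^ (j + 1)) (fine L (fun _ : Fin 4 => M (j + 1))) μ))))
                ⬝ᵥ ((effLaplacian (L ^ (j + 1)) (fine L (fun _ : Fin 4 => M (j + 1))) (aK a L (j + 1))
                        (((L ^ (j + 1) : ℕ) : ℝ) ^ 2) m2
                      + (a * ((L : ℝ) ^ 2)⁻¹) • blockProj L (fun _ : Fin 4 => M (j + 1)))⁻¹
                    *ᵥ fun w' => minimiser (L ^ (j + 1)) (fine L (fun _ : Fin 4 => M (j + 1))) (aK a L (j + 1))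
                        (((L ^ (j + 1) : ℕ) : ℝ) ^ 2) m2 (Pi.single w' 1)
                        (fun μ => (((xy.2 μ).val / L ^ n : ℕ) :
                          ZMod (fine (L ^ (j + 1)) (fine L (fun _ : Fin 4 => M (j + 1))) μ))))) ∧
            KB ⟨j, X⟩ φ = ∑ xy ∈ S, ((((L ^ n * L ^ (j + 1) : ℕ) : ℝ) ^ 4)⁻¹ * u j φ xy.1 * ((((L ^ n * L ^ (j + 1) : ℕ) : ℝ) ^ 4)⁻¹ * v j φ xy.2)) *
              ((fun z => minimiser (L ^ n * L ^ (j + 1)) (fine L (fun _ : Fin 4 => M (j + 1))) (aK a L (j + 1 + n))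
                    (((L ^ n * L ^ (j + 1) : ℕ) : ℝ) ^ 2) m2 (Pi.single z 1) xy.1)
                ⬝ᵥ ((effLaplacian (L ^ n * L ^ (j + 1)) (fine L (fun _ : Fin 4 => M (j + 1))) (aK a L (j + 1 + n))
                        (((L ^ n * L ^ (j + 1) : ℕ) : ℝ) ^ 2) m2
                      + (a * ((L : ℝ) ^ 2)⁻¹) • blockProj L (fun _ : Fin 4 => M (j + 1)))⁻¹
                    *ᵥ fun w' => minimiser (L ^ n * L ^ (j + 1)) (fine L (fun _ : Fin 4 => M (j + 1)))
                        (aK a L (j + 1 + n)) (((L ^ n * L ^ (j + 1) : ℕ) : ℝ) ^ 2) m2 (Pi.single w' 1) xy.2))) := by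
  obtain ⟨κ, A, C₅, hκ, hA, hC₅, H⟩ := kingModel_polymerRep_finePoints (L' := L') L hLp ha hm hγ0 hγ1
  refine ⟨κ, A, C₅, hκ, hA, hC₅, ?_⟩
  intro n hn M _ hM W u v hu hv W'
  exact H n hn M hM W (fun j φ xy => (((L ^ n * L ^ (j + 1) : ℕ) : ℝ) ^ 4)⁻¹ * u j φ xy.1
      * ((((L ^ n * L ^ (j + 1) : ℕ) : ℝ) ^ 4)⁻¹ * v j φ xy.2))
    (fun j φ pq => blockMeans_normalised (L ^ n * L ^ (j + 1)) (fine L (fun _ : Fin 4 => M (j + 1)))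
      (hu j φ) (hv j φ) pq) W'

end Capstone

/-! ## §3 (v1.1 APPEND, 2026-08-27) Gaussian block volumes at a slice — the LENS card T6′ hypothesis `hvol` (pub-ymgap INBOX
[LENS-TRANSFER-G4-1], kill-test (a′); answer [DAGN18E-G5-ANSWER-LENS-T6′]): with King's slices `s = L^jη ≥ η` the Gaussian-weighted
block volume GAINS `s^d` — `η^d·Σ_y e^{−δ₀η|x−y|_T∕(2s)} ≤ (2 + 4d∕δ₀)^d·s^d` uniformly in the torus (`tdistT_sumBound` at rate
`δ₀η∕(2s)`, `latticeConst d b ≤ (2(1 + d∕b))^d`). -/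

section GaussianVolume
variable {d : ℕ}

open Literature.MathematicalPhysics.QuantumFieldTheory.Balaban1983to89.B4Sect5Proof (latticeConst latticeConst_nonneg)
open Literature.MathematicalPhysics.QuantumFieldTheory.King1986.Torus (tdistT tdistT_sumBound)

/-- **The lattice-sum constant at small rate**: `K_d(b) = (2(1 − e^{−b∕d})⁻¹)^d ≤ (2(1 + d∕b))^d` (`1 − e^{−t} ≥ t∕(1 + t)`).
[folklore] -/
theorem latticeConst_le_of_pos (hd : 0 < d) {b : ℝ} (hb : 0 < b) : latticeConst d b ≤ (2 * (1 + d / b)) ^ d := by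
  have hd' : (0 : ℝ) < d := by exact_mod_cast hd
  set t : ℝ := b / d with ht
  have htpos : 0 < t := div_pos hb hd'
  -- `e^{-t} ≤ 1/(1+t)`, i.e. `(1 - e^{-t})⁻¹ ≤ 1 + 1/t`
  have hexp : Real.exp (-t) ≤ 1 / (1 + t) := by
    rw [Real.exp_neg, one_div]
    exact inv_anti₀ (by linarith) (by linarith [Real.add_one_le_exp t])
  have h1 : t / (1 + t) ≤ 1 - Real.exp (-t) := by
    have : 1 - 1 / (1 + t) = t / (1 + t) := by field_simp; ring
    linarith
  have hpos : 0 < t / (1 + t) := div_pos htpos (by linarith)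
  have hinv : (1 - Real.exp (-t))⁻¹ ≤ (t / (1 + t))⁻¹ := inv_anti₀ hpos h1
  have heq : (t / (1 + t))⁻¹ = 1 + d / b := by
    rw [inv_div, ht]; field_simp; ring
  have hbase : 0 ≤ 2 * (1 - Real.exp (-t))⁻¹ :=
    mul_nonneg (by norm_num) (inv_nonneg.2 (hpos.le.trans h1))
  unfold latticeConst
  rw [show b / (d : ℝ) = t from rfl]
  exact pow_le_pow_left₀ hbase (by rw [← heq]; exact mul_le_mul_of_nonneg_left hinv (by norm_num)) d

/-- **GAUSSIAN BLOCK VOLUME AT A SLICE (the volume gain).**  On any torus `Π ℤ∕K_μ` (lattice units) with spacing `η > 0` and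
slice `s ≥ η`, rate `δ₀ > 0`: `η^d · Σ_y e^{−δ₀·η·|x − y|_T∕(2s)} ≤ (2 + 4d∕δ₀)^d · s^d` — an ABSOLUTE constant, uniform in the
periods and in `x` (`King1986.Torus.tdistT_sumBound` at rate `δ₀η∕(2s)` and `latticeConst_le_of_pos`); the hypothesis `hvol`
of the lens's smeared slice letter (King (3.73) + (2.17), card T6′). [cite: King1986, (2.17) p.653 and p.674] -/
theorem gaussianBlockVolume_le (hd : 0 < d) (K : Fin d → ℕ) [∀ μ, NeZero (K μ)] {η s δ₀ : ℝ} (hη : 0 < η)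
    (hηs : η ≤ s) (hδ : 0 < δ₀) (x : Tor K) :
    η ^ d * ∑ y, Real.exp (-(δ₀ * η / (2 * s) * tdistT K x y)) ≤ (2 + 4 * d / δ₀) ^ d * s ^ d := by
  have hs : 0 < s := lt_of_lt_of_le hη hηs
  have hb : 0 < δ₀ * η / (2 * s) := by positivity
  have hsum := tdistT_sumBound K (δ₀ * η / (2 * s)) hb x
  have hK := latticeConst_le_of_pos hd hb
  have hd' : (0 : ℝ) < d := by exact_mod_cast hd
  calc η ^ d * ∑ y, Real.exp (-(δ₀ * η / (2 * s) * tdistT K x y))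
      ≤ η ^ d * (2 * (1 + d / (δ₀ * η / (2 * s)))) ^ d :=
        mul_le_mul_of_nonneg_left (hsum.trans hK) (pow_nonneg hη.le d)
    _ = (η * (2 * (1 + d / (δ₀ * η / (2 * s))))) ^ d := by rw [← mul_pow]
    _ = (2 * η + 4 * d / δ₀ * s) ^ d := by
        congr 1
        field_simp
        ring
    _ ≤ (2 * s + 4 * d / δ₀ * s) ^ d := by
        apply pow_le_pow_left₀ (by positivity)
        have : 0 ≤ 4 * d / δ₀ * s := by positivity
        linarith
    _ = (2 + 4 * d / δ₀) ^ d * s ^ d := by rw [← mul_pow]; ring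

end GaussianVolume

end Summit.QuantumFields.YangMills.BalabanUVNodes.N18KingModelBlockMeans

end
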